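import Literature.NumberTheory.Automorphic.UnitaryAntidiagTransvections
import HarnessLib

/-!
# Cartan decomposition of the quasi-split unitary group `U(J₀)(K)`, `J₀ = antidiag(1,…,1)` — I: the frame induction
# (Tits 1979 §3.3.3; Bruhat–Tits 1972 §4.4; lattice proof, O'Meara §82F)

Topic `NumberTheory/Automorphic`; namespace `Literature.NumberTheory.Automorphic.HermitianLattice`.
THEOREMS only (plus `rfl`-plumbing on `Submodule.map`); no definition, no named fact, no `sorry`.

Setting (`HermitianLatticesLocal`): `K` with `Valued K ℤᵐ⁰`, an involution `σ` preserving the valuation, a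
`σ`-fixed uniformiser `ϖ`, `2 ∈ 𝒪ˣ`, Hensel square roots (`LocalConjDatum σ ϖ` — e.g. `K = E_w` at an inert
non-dyadic place of a quadratic extension of number fields) — or, for EVERY residue characteristic, the datum
`UnramifiedLocalConjDatum σ ϖ` ((trace) + (norm); the theorems in that namespace, of which the `LocalConjDatum`
ones are specialisations); the split Hermitian space `(K^N, B₀)`,
`B₀ x y = ∑ σ(x i) y (rev i)` (`UnitaryAntidiagFrames`), its standard lattice `𝒪^N`, coordinate frames `K^S`, `𝒪^S`.

* `exists_unit_coord` — in a hyperbolic pair `x, y ∈ 𝒪^S`, `x` has a unit coordinate at some `i₀ ∈ S` with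
  `rev i₀ ≠ i₀` (`B₀ x y = 1` gives a unit coordinate; were it only the `rev`-fixed one, `B₀ x x ≢ 0`).
* `exists_frame_cartan` — the inductive statement over `rev`-closed frames `S ⊆ Fin N`: every unimodular lattice
  `M` in `K^S` is `ψ(t_d 𝒪^S)` for a `B₀`-isometry `ψ` of `K^N` with `ψ(𝒪^N) = 𝒪^N` fixing the `e i`, `i ∉ S`, and a
  diagonal `t_d = diag(d)` with `σ d = d`, `d i · d (rev i) = 1`, `d = 1` off `S`.  Step: an ADAPTED HYPERBOLIC PAIR
  `x, y ∈ 𝒪^S` for `(𝒪^S, M)` (`exists_adapted_hyperbolicPair`), normalised at a unit coordinate `i₀`; two unitary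
  transvections (`UnitaryAntidiagTransvections`) give `φ ∈ U(J₀)(𝒪)` supported on `S` with `φ e i₀ = x`,
  `φ e (rev i₀) = y`; then `φ⁻¹ M = (𝒪 ϖ^{-a} e i₀ ⊕ 𝒪 ϖ^{a} e (rev i₀)) ⊕ M'` with `M'` unimodular in
  `K^{S ∖ {i₀, rev i₀}}` (`IsUnimodularLattice.restrict`), and induction.
The matrix form (Cartan decomposition `U(J₀)(K) = K₀ T K₀`) is in `HyperspecialUnitaryCartan`.

References: J. Tits, *Reductive groups over local fields*, PSPUM 33.1 (1979), §3.3.3 [Tits1979];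
F. Bruhat, J. Tits, *Groupes réductifs sur un corps local I*, Publ. IHÉS 41 (1972), §4.4 [BruhatTits1972];
O. T. O'Meara, *Introduction to Quadratic Forms* (1963), §42D, §81A, §82F [Omeara1963].
-/

noncomputable section

open scoped Valued WithZero Matrix

namespace Literature.NumberTheory.Automorphic.HermitianLattice

variable {K : Type*} [Field K] [Valued K ℤᵐ⁰] {σ : K →+* K} {ϖ : K} {N : ℕ}

/-! ## §1 Plumbing: images of lattices under linear automorphisms -/

section Plumbing

variable {V : Type*} [AddCommGroup V] [Module K V]

/-- `(M.map φ⁻¹).map φ = M`. [cite: Omeara1963, §81A] -/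
theorem map_symm_map (φ : V ≃ₗ[K] V) (M : Submodule 𝒪[K] V) :
    (M.map (φ.symm.toLinearMap.restrictScalars 𝒪[K])).map (φ.toLinearMap.restrictScalars 𝒪[K]) = M := by
  ext z
  constructor
  · rintro ⟨_, ⟨m, hm, rfl⟩, rfl⟩
    simpa using hm
  · intro hz
    exact ⟨φ.symm z, ⟨z, hz, rfl⟩, by simp⟩

/-- `(M.map φ).map φ⁻¹ = M`. [cite: Omeara1963, §81A] -/
theorem map_map_symm (φ : V ≃ₗ[K] V) (M : Submodule 𝒪[K] V) :
    (M.map (φ.toLinearMap.restrictScalars 𝒪[K])).map (φ.symm.toLinearMap.restrictScalars 𝒪[K]) = M :=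
  map_symm_map φ.symm M

/-- `M.map (ψ ∘ φ) = (M.map φ).map ψ` for linear automorphisms. [cite: Omeara1963, §81A] -/
theorem map_trans (φ ψ : V ≃ₗ[K] V) (M : Submodule 𝒪[K] V) :
    M.map ((φ.trans ψ).toLinearMap.restrictScalars 𝒪[K]) =
      (M.map (φ.toLinearMap.restrictScalars 𝒪[K])).map (ψ.toLinearMap.restrictScalars 𝒪[K]) := by
  rw [← Submodule.map_comp]; rfl

/-- The identity restricted to `𝒪`. [cite: Omeara1963, §81A] -/
theorem restrictScalars_refl :
    ((LinearEquiv.refl K V).toLinearMap.restrictScalars 𝒪[K]) = LinearMap.id := rfl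

/-- `LinearMap.id` restricted to `𝒪`. [cite: Omeara1963, §81A] -/
theorem restrictScalars_id : ((LinearMap.id : V →ₗ[K] V).restrictScalars 𝒪[K]) = LinearMap.id := rfl

omit [Valued K ℤᵐ⁰] in
/-- `W.map (ψ ∘ φ) = (W.map φ).map ψ` for `K`-subspaces. [cite: Omeara1963, §81A] -/
theorem map_trans' (φ ψ : V ≃ₗ[K] V) (W : Submodule K V) :
    W.map (φ.trans ψ).toLinearMap = (W.map φ.toLinearMap).map ψ.toLinearMap := by
  rw [← Submodule.map_comp]; rfl

/-- Two maps agreeing on `M` have the same image. [cite: Omeara1963, §81A] -/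
theorem map_eq_map_of_eqOn {f g : V →ₗ[K] V} {M : Submodule 𝒪[K] V} (h : ∀ z ∈ M, f z = g z) :
    M.map (f.restrictScalars 𝒪[K]) = M.map (g.restrictScalars 𝒪[K]) := by
  ext z
  simp only [Submodule.mem_map, LinearMap.coe_restrictScalars]
  constructor
  · rintro ⟨w, hw, rfl⟩; exact ⟨w, hw, (h w hw).symm⟩
  · rintro ⟨w, hw, rfl⟩; exact ⟨w, hw, h w hw⟩

/-- Image of a pair span. [cite: Omeara1963, §81A] -/
theorem map_span_pair (f : V →ₗ[K] V) (u w : V) :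
    (Submodule.span 𝒪[K] {u, w}).map (f.restrictScalars 𝒪[K]) = Submodule.span 𝒪[K] {f u, f w} := by
  rw [Submodule.map_span, Set.image_pair]; rfl

omit [Valued K ℤᵐ⁰] in
/-- If `K`-linear `φ` maps `W` onto itself, so does `φ⁻¹`. [cite: Omeara1963, §81A] -/
theorem map_symm_eq_self {φ : V ≃ₗ[K] V} {W : Submodule K V} (h : W.map φ.toLinearMap = W) :
    W.map φ.symm.toLinearMap = W := by
  conv_lhs => rw [← h]
  rw [← Submodule.map_comp]
  convert Submodule.map_id W
  ext z; simp

/-- **Transport of unimodularity along an isometric automorphism.** [cite: Omeara1963, §82F] -/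
theorem IsUnimodularLattice.map_equiv' {B : V →ₛₗ[σ] V →ₗ[K] K} {W : Submodule K V} {L : Submodule 𝒪[K] V}
    (hL : IsUnimodularLattice B W L) (φ : V ≃ₗ[K] V) (hφ : ∀ u v, B (φ u) (φ v) = B u v) :
    IsUnimodularLattice B (W.map φ.toLinearMap) (L.map (φ.toLinearMap.restrictScalars 𝒪[K])) := by
  refine ⟨hL.fg.map _, ?_, ?_, ?_⟩
  · rw [← hL.span_eq, Submodule.map_span, Submodule.map_coe]; rfl
  · rintro _ ⟨x, hx, rfl⟩ _ ⟨y, hy, rfl⟩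
    simpa only [LinearMap.coe_restrictScalars, LinearEquiv.coe_coe, hφ] using hL.integral x hx y hy
  · rintro _ ⟨w, hw, rfl⟩ hz
    refine ⟨w, hL.dual w hw fun x hx => ?_, rfl⟩
    have := hz (φ x) ⟨x, hx, rfl⟩
    rwa [LinearEquiv.coe_coe, hφ] at this

end Plumbing

/-! ## §2 A unit coordinate of a hyperbolic pair in `𝒪^S` -/

/-- The fixed point of `rev` on `Fin N` is unique. [cite: Tits1979, §3.3.3] -/
theorem Fin.eq_of_rev_eq_self {i j : Fin N} (hi : Fin.rev i = i) (hj : Fin.rev j = j) : i = j := by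
  have h1 := congrArg Fin.val hi
  have h2 := congrArg Fin.val hj
  rw [Fin.val_rev] at h1 h2
  exact Fin.ext (by omega)

/-- In a hyperbolic pair `x, y ∈ 𝒪^S`, `x` has a UNIT coordinate at an index `i₀ ∈ S` with `rev i₀ ≠ i₀`:
`B₀ x y = 1` forces a unit coordinate, and if the only one were the `rev`-fixed index `m` then `B₀ x x ≡ N(x m) ≢ 0`.
[cite: Tits1979, §3.3.3] -/
theorem exists_unit_coord (hvσ : ∀ a, Valued.v (σ a) = Valued.v a) {S : Finset (Fin N)} {x y : Fin N → K}
    (hx : x ∈ frameLattice K N S) (hy : y ∈ frameLattice K N S) (hp : IsHyperbolicPair (B₀ σ N) x y) :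
    ∃ i₀ ∈ S, Fin.rev i₀ ≠ i₀ ∧ Valued.v (x i₀) = 1 := by
  obtain ⟨hx1, hxS⟩ := mem_frameLattice.1 hx
  obtain ⟨hy1, -⟩ := mem_frameLattice.1 hy
  -- a unit coordinate exists
  by_contra H
  push Not at H
  have hlt : ∀ i, Fin.rev i ≠ i → Valued.v (x i) < 1 := by
    intro i hi
    by_cases hiS : i ∈ S
    · exact lt_of_le_of_ne (hx1 i) (H i hiS hi)
    · rw [hxS i hiS, map_zero]; exact zero_lt_one
  -- case split on whether `rev` has a fixed point carrying a unit
  by_cases hm : ∃ m : Fin N, Fin.rev m = m ∧ Valued.v (x m) = 1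
  · obtain ⟨m, hmrev, hmunit⟩ := hm
    -- `B₀ x x = σ(x m) x m + (terms of valuation < 1)`
    have hsplit : B₀ σ N x x = σ (x m) * x m + ∑ k ∈ Finset.univ.erase m, σ (x k) * x (Fin.rev k) := by
      rw [B₀_apply, ← Finset.add_sum_erase _ _ (Finset.mem_univ m), hmrev]
    have hsmall : Valued.v (∑ k ∈ Finset.univ.erase m, σ (x k) * x (Fin.rev k)) < 1 := by
      refine Valuation.map_sum_lt _ one_ne_zero fun k hk => ?_
      have hkm : k ≠ m := (Finset.mem_erase.1 hk).1
      have hkrev : Fin.rev k ≠ k := fun h => hkm (Fin.eq_of_rev_eq_self h hmrev)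
      rw [map_mul, hvσ]
      calc Valued.v (x k) * Valued.v (x (Fin.rev k)) ≤ Valued.v (x k) * 1 := mul_le_mul' le_rfl (hx1 _)
        _ < 1 := by rw [mul_one]; exact hlt k hkrev
    have hbig : Valued.v (σ (x m) * x m) = 1 := by rw [map_mul, hvσ, hmunit, one_mul]
    have h := hp.left
    rw [hsplit] at h
    have : Valued.v (σ (x m) * x m + ∑ k ∈ Finset.univ.erase m, σ (x k) * x (Fin.rev k)) = 1 := by
      rw [Valuation.map_add_eq_of_lt_left _ (by rw [hbig]; exact hsmall), hbig]
    rw [h, map_zero] at this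
    exact zero_ne_one this
  · push Not at hm
    have hall : ∀ i, Valued.v (x i) < 1 := by
      intro i
      by_cases hi : Fin.rev i = i
      · exact lt_of_le_of_ne (hx1 i) (hm i hi)
      · exact hlt i hi
    have h := hp.pair
    have : Valued.v (B₀ σ N x y) < 1 := by
      rw [B₀_apply]
      refine Valuation.map_sum_lt _ one_ne_zero fun k _ => ?_
      rw [map_mul, hvσ]
      calc Valued.v (x k) * Valued.v (y (Fin.rev k)) ≤ Valued.v (x k) * 1 := mul_le_mul' le_rfl (hy1 _)
        _ < 1 := by rw [mul_one]; exact hall k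
    rw [h, map_one] at this
    exact lt_irrefl _ this

omit [Valued K ℤᵐ⁰] in
/-- Rescaling a hyperbolic pair by a unit to normalise a coordinate: `(t⁻¹ x, σ(t) y)`. [cite: Omeara1963, §42D] -/
theorem IsHyperbolicPair.smul_unit {V : Type*} [AddCommGroup V] [Module K V] {B : V →ₛₗ[σ] V →ₗ[K] K} {x y : V}
    (h : IsHyperbolicPair B x y) {t : K} (ht : t ≠ 0) : IsHyperbolicPair B (t⁻¹ • x) (σ t • y) := by
  refine ⟨?_, ?_, ?_⟩
  · rw [form_smul_left, form_smul_right, h.left, mul_zero, mul_zero]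
  · rw [form_smul_left, form_smul_right, h.right, mul_zero, mul_zero]
  · rw [form_smul_left, form_smul_right, h.pair, mul_one, map_inv₀, inv_mul_cancel₀ ((map_ne_zero σ).2 ht)]

/-! ## §3 The frame induction -/

omit [Valued K ℤᵐ⁰] in
/-- `diag(d) e i = d i • e i`. [cite: Tits1979, §3.3.3] -/
theorem toLin'_diagonal_single (d : Fin N → K) (i : Fin N) :
    Matrix.toLin' (Matrix.diagonal d) (Pi.single i 1) = d i • (Pi.single i 1 : Fin N → K) := by
  rw [Matrix.toLin'_apply, Matrix.diagonal_mulVec_single, mul_one]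
  ext k
  rw [Pi.smul_apply, Pi.single_apply, Pi.single_apply, smul_eq_mul, mul_ite, mul_one, mul_zero]

/-- **The frame induction — every residue characteristic** (datum `UnramifiedLocalConjDatum σ ϖ`: `σ`-fixed
uniformiser, (trace), (norm); see the module docstring): every unimodular lattice `M` in `K^S` is `ψ(t_d 𝒪^S)` for a
`B₀`-isometry `ψ` of `K^N` with `ψ(𝒪^N) = 𝒪^N` fixing the `e i`, `i ∉ S`, and a `σ`-fixed diagonal `t_d` with
`d i · d (rev i) = 1`, `d = 1` off `S`.  The adapted hyperbolic pair of the step is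
`UnramifiedLocalConjDatum.exists_adapted_hyperbolicPair`. [cite: Tits1979, §3.3.3; Jacobowitz1962, §7] -/
theorem UnramifiedLocalConjDatum.exists_frame_cartan (hd : UnramifiedLocalConjDatum σ ϖ) (S : Finset (Fin N))
    (hS : ∀ i ∈ S, Fin.rev i ∈ S)
    (M : Submodule 𝒪[K] (Fin N → K)) (hM : IsUnimodularLattice (B₀ σ N) (frame K N S) M) :
    ∃ (ψ : (Fin N → K) ≃ₗ[K] (Fin N → K)) (d : Fin N → K),
      (∀ u v, B₀ σ N (ψ u) (ψ v) = B₀ σ N u v) ∧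
      (∀ i, i ∉ S → ψ (Pi.single i 1) = Pi.single i 1) ∧
      (stdLattice K N).map (ψ.toLinearMap.restrictScalars 𝒪[K]) = stdLattice K N ∧
      (∀ i, σ (d i) = d i) ∧ (∀ i, d i * d (Fin.rev i) = 1) ∧ (∀ i, i ∉ S → d i = 1) ∧
      M = ((frameLattice K N S).map ((Matrix.toLin' (Matrix.diagonal d)).restrictScalars 𝒪[K])).map
            (ψ.toLinearMap.restrictScalars 𝒪[K]) := by
  have hB : IsHermitianForm (B₀ σ N) := isHermitianForm_B₀ hd.σσ
  induction S using Finset.strongInduction generalizing M with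
  | H S ih =>
  have hL := isUnimodularLattice_frameLattice (N := N) hd.vσ hS
  by_cases hML : M ≤ frameLattice K N S
  · -- `M = 𝒪^S`: identity and `d = 1`
    have hEq : M = frameLattice K N S := hL.eq_of_le hM hML
    refine ⟨LinearEquiv.refl K _, fun _ => 1, fun u v => rfl, fun i _ => rfl, ?_, fun _ => map_one σ,
      fun _ => mul_one 1, fun _ _ => rfl, ?_⟩
    · rw [restrictScalars_refl, Submodule.map_id]
    · rw [hEq, Matrix.diagonal_one, Matrix.toLin'_one, restrictScalars_id, Submodule.map_id, restrictScalars_refl,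
        Submodule.map_id]
  · -- an adapted hyperbolic pair, normalised at a unit coordinate `i₀`
    obtain ⟨a, x, y, ha, hp, hxL, hyL, hxM, hyM⟩ := hd.exists_adapted_hyperbolicPair hB hL hM hML
    obtain ⟨i₀, hi₀S, hi₀, hunit⟩ := exists_unit_coord hd.vσ hxL hyL hp
    have hi₁S : Fin.rev i₀ ∈ S := hS i₀ hi₀S
    have hi₁' : Fin.rev (Fin.rev i₀) ≠ Fin.rev i₀ := by rw [Fin.rev_rev]; exact hi₀.symm
    have hne : i₀ ≠ Fin.rev i₀ := fun h => hi₀ h.symm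
    -- the scalar `P = ϖ^a`
    have hP0 : ϖ ^ a ≠ 0 := pow_ne_zero _ hd.ϖ_ne_zero
    have hσP : σ (ϖ ^ a) = ϖ ^ a := hd.σ_pow a
    obtain ⟨P, hPdef⟩ : ∃ P : K, ϖ ^ a = P := ⟨_, rfl⟩
    rw [hPdef] at hP0 hσP hxM hyM
    -- rescale: `x' = t⁻¹ x`, `y' = σ t y`, `t = x i₀`
    have ht0 : x i₀ ≠ 0 := fun h => by rw [h, map_zero] at hunit; exact zero_ne_one hunit
    have hvt' : Valued.v (x i₀)⁻¹ ≤ 1 := by rw [map_inv₀, hunit, inv_one]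
    have hvσt : Valued.v (σ (x i₀)) ≤ 1 := by rw [hd.vσ, hunit]
    obtain ⟨x', hx'⟩ : ∃ x' : Fin N → K, (x i₀)⁻¹ • x = x' := ⟨_, rfl⟩
    obtain ⟨y', hy'⟩ : ∃ y' : Fin N → K, σ (x i₀) • y = y' := ⟨_, rfl⟩
    have hp' : IsHyperbolicPair (B₀ σ N) x' y' := hx' ▸ hy' ▸ hp.smul_unit ht0
    have hx'L : x' ∈ frameLattice K N S := hx' ▸ smul_mem_of_v_le _ hvt' hxL
    have hy'L : y' ∈ frameLattice K N S := hy' ▸ smul_mem_of_v_le _ hvσt hyL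
    have hx'M : P⁻¹ • x' ∈ M := by rw [← hx', smul_comm]; exact smul_mem_of_v_le _ hvt' hxM
    have hy'M : P • y' ∈ M := by rw [← hy', smul_comm]; exact smul_mem_of_v_le _ hvσt hyM
    have hx'1 : x' i₀ = 1 := by rw [← hx', Pi.smul_apply, smul_eq_mul, inv_mul_cancel₀ ht0]
    have hx'0 : B₀ σ N x' x' = 0 := hp'.left
    obtain ⟨hx'int, hx'S⟩ := mem_frameLattice.1 hx'L
    obtain ⟨hy'int, hy'S⟩ := mem_frameLattice.1 hy'L
    -- first transvection `τ₁ : e i₀ ↦ x'`; `y'' := τ₁⁻¹ y'`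
    set τ₁ := transvEquiv hd.σσ hi₀ hx'1 hx'0 with hτ₁
    obtain ⟨y'', hy''⟩ : ∃ y'' : Fin N → K, τ₁.symm y' = y'' := ⟨_, rfl⟩
    have hτ₁y'' : τ₁ y'' = y' := by rw [← hy'', LinearEquiv.apply_symm_apply]
    have hy''1 : y'' (Fin.rev i₀) = 1 := by
      have h := B₀_transv hd.σσ hi₀ hx'1 hx'0 (Pi.single i₀ 1) y''
      rw [transv_single_self hi₀, ← transvEquiv_apply hd.σσ hi₀ hx'1 hx'0, hτ₁y'', hp'.pair, B₀_single_left] at h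
      exact h.symm
    have hy''0 : B₀ σ N y'' y'' = 0 := by
      have h := B₀_transv hd.σσ hi₀ hx'1 hx'0 y'' y''
      rw [← transvEquiv_apply hd.σσ hi₀ hx'1 hx'0, hτ₁y'', hp'.right] at h
      exact h.symm
    have hy''int : y'' ∈ stdLattice K N :=
      hy'' ▸ transv_mem_stdLattice hd.vσ (transvDual_mem_stdLattice hi₀ hd.vσ hx'int) hy'int
    have hy''S : y'' ∈ frame K N S :=
      hy'' ▸ transv_mem_frame hi₀S hi₁S (transvDual_mem_frame hi₀S hi₁S hx'S) hy'S
    -- second transvection `τ₂ : e (rev i₀) ↦ y''` (it fixes `e i₀`); `φ := τ₁ ∘ τ₂`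
    set τ₂ := transvEquiv hd.σσ hi₁' hy''1 hy''0 with hτ₂
    set φ := τ₂.trans τ₁ with hφ
    have hφapply : ∀ z, φ z = transv σ N i₀ x' (transv σ N (Fin.rev i₀) y'' z) := fun z => rfl
    have hφiso : ∀ u v, B₀ σ N (φ u) (φ v) = B₀ σ N u v := fun u v => by
      rw [hφapply, hφapply, B₀_transv hd.σσ hi₀ hx'1 hx'0, B₀_transv hd.σσ hi₁' hy''1 hy''0]
    have hφe₀ : φ (Pi.single i₀ 1) = x' := by
      have h1 : transv σ N (Fin.rev i₀) y'' (Pi.single i₀ 1) = Pi.single i₀ 1 := by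
        have h := transv_single_rev (σ := σ) hi₁' hy''1
        rwa [Fin.rev_rev] at h
      rw [hφapply, h1, transv_single_self hi₀]
    have hφe₁ : φ (Pi.single (Fin.rev i₀) 1) = y' := by
      rw [hφapply, transv_single_self hi₁', ← hτ₁y'']; rfl
    have hφfix : ∀ k, k ∉ S → φ (Pi.single k 1) = Pi.single k 1 := by
      intro k hk
      have hk0 : k ≠ i₀ := fun h => hk (h ▸ hi₀S)
      have hk1 : k ≠ Fin.rev i₀ := fun h => hk (h ▸ hi₁S)
      have hkr : Fin.rev k ∉ S := fun h => hk (by simpa using hS _ h)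
      rw [hφapply, transv_single_of_eq_zero hk1 (by rw [Fin.rev_rev]; exact hk0) (hy''S _ hkr),
        transv_single_of_eq_zero hk0 hk1 (hx'S _ hkr)]
    have hφstd : (stdLattice K N).map (φ.toLinearMap.restrictScalars 𝒪[K]) = stdLattice K N := by
      rw [hφ, map_trans, map_transvEquiv_stdLattice hd.σσ hi₁' hy''1 hy''0 hd.vσ hy''int,
        map_transvEquiv_stdLattice hd.σσ hi₀ hx'1 hx'0 hd.vσ hx'int]
    have hφframe : (frame K N S).map φ.toLinearMap = frame K N S := by
      rw [hφ, map_trans', map_transvEquiv_frame hd.σσ hi₁' hy''1 hy''0 hi₁S (by rw [Fin.rev_rev]; exact hi₀S) hy''S,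
        map_transvEquiv_frame hd.σσ hi₀ hx'1 hx'0 hi₀S hi₁S hx'S]
    -- transport `M` along `φ⁻¹`
    have hφsymm_iso : ∀ u v, B₀ σ N (φ.symm u) (φ.symm v) = B₀ σ N u v := fun u v => by
      conv_rhs => rw [← φ.apply_symm_apply u, ← φ.apply_symm_apply v]
      exact (hφiso _ _).symm
    have hM₁ : IsUnimodularLattice (B₀ σ N) (frame K N S) (M.map (φ.symm.toLinearMap.restrictScalars 𝒪[K])) := by
      have h := hM.map_equiv' φ.symm hφsymm_iso
      rwa [map_symm_eq_self hφframe] at h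
    have he₀ : φ.symm x' = Pi.single i₀ 1 := by rw [← hφe₀, LinearEquiv.symm_apply_apply]
    have he₁ : φ.symm y' = Pi.single (Fin.rev i₀) 1 := by rw [← hφe₁, LinearEquiv.symm_apply_apply]
    have he₀M₁ : P⁻¹ • (Pi.single i₀ 1 : Fin N → K) ∈ M.map (φ.symm.toLinearMap.restrictScalars 𝒪[K]) :=
      ⟨P⁻¹ • x', hx'M, by rw [LinearMap.coe_restrictScalars, LinearEquiv.coe_coe, map_smul, he₀]⟩
    have he₁M₁ : P • (Pi.single (Fin.rev i₀) 1 : Fin N → K) ∈ M.map (φ.symm.toLinearMap.restrictScalars 𝒪[K]) :=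
      ⟨P • y', hy'M, by rw [LinearMap.coe_restrictScalars, LinearEquiv.coe_coe, map_smul, he₁]⟩
    -- split off the standard plane and restrict to the frame `S' = S ∖ {i₀, rev i₀}`
    have hpair : IsHyperbolicPair (B₀ σ N) (P⁻¹ • (Pi.single i₀ 1 : Fin N → K)) (P • Pi.single (Fin.rev i₀) 1) :=
      (isHyperbolicPair_single hi₀).smul hP0 hσP
    obtain ⟨hM₁', hM₁dec⟩ := hM₁.restrict hB hpair he₀M₁ he₁M₁
    rw [orth_smul (inv_ne_zero hP0) hP0, frame_inf_orth_single, orthInt_smul (inv_ne_zero hP0) hP0] at hM₁'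
    rw [orthInt_smul (inv_ne_zero hP0) hP0] at hM₁dec
    have hsub : (S.erase i₀).erase (Fin.rev i₀) ⊂ S :=
      (Finset.erase_subset _ _).trans_ssubset (Finset.erase_ssubset hi₀S)
    have hS'rev : ∀ i ∈ (S.erase i₀).erase (Fin.rev i₀), Fin.rev i ∈ (S.erase i₀).erase (Fin.rev i₀) := by
      intro i hi
      simp only [Finset.mem_erase] at hi ⊢
      obtain ⟨hi1, hi2, hi3⟩ := hi
      exact ⟨fun h => hi2 (Fin.rev_injective h), fun h => hi1 (by rw [← h, Fin.rev_rev]), hS i hi3⟩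
    have hi₀S' : i₀ ∉ (S.erase i₀).erase (Fin.rev i₀) := by simp
    have hi₁S' : Fin.rev i₀ ∉ (S.erase i₀).erase (Fin.rev i₀) := by simp
    obtain ⟨ψ', d', hψ'iso, hψ'fix, hψ'L, hd'σ, hd'inv, hd'1, hM₁'eq⟩ := ih _ hsub hS'rev _ hM₁'
    -- the new diagonal
    obtain ⟨d, hd⟩ : ∃ d : Fin N → K, Function.update (Function.update d' i₀ P⁻¹) (Fin.rev i₀) P = d := ⟨_, rfl⟩
    have hd₁ : d (Fin.rev i₀) = P := by rw [← hd, Function.update_self]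
    have hd₀ : d i₀ = P⁻¹ := by rw [← hd, Function.update_of_ne hne, Function.update_self]
    have hd'' : ∀ k, k ≠ i₀ → k ≠ Fin.rev i₀ → d k = d' k := fun k hk0 hk1 => by
      rw [← hd, Function.update_of_ne hk1, Function.update_of_ne hk0]
    have hagree : ∀ z ∈ frameLattice K N ((S.erase i₀).erase (Fin.rev i₀)),
        Matrix.toLin' (Matrix.diagonal d) z = Matrix.toLin' (Matrix.diagonal d') z := by
      intro z hz
      obtain ⟨-, hzS⟩ := mem_frameLattice.1 hz
      ext k
      rw [Matrix.toLin'_apply, Matrix.toLin'_apply, Matrix.mulVec_diagonal, Matrix.mulVec_diagonal]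
      by_cases hk0 : k = i₀
      · rw [hk0, hzS _ hi₀S', mul_zero, mul_zero]
      by_cases hk1 : k = Fin.rev i₀
      · rw [hk1, hzS _ hi₁S', mul_zero, mul_zero]
      · rw [hd'' k hk0 hk1]
    refine ⟨ψ'.trans φ, d, ?_, ?_, ?_, ?_, ?_, ?_, ?_⟩
    · intro u v
      change B₀ σ N (φ (ψ' u)) (φ (ψ' v)) = _
      rw [hφiso, hψ'iso]
    · intro k hk
      change φ (ψ' (Pi.single k 1)) = _
      rw [hψ'fix k (fun h => hk (hsub.subset h)), hφfix k hk]
    · rw [map_trans, hψ'L, hφstd]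
    · intro k
      by_cases hk0 : k = i₀
      · rw [hk0, hd₀, map_inv₀, hσP]
      by_cases hk1 : k = Fin.rev i₀
      · rw [hk1, hd₁, hσP]
      · rw [hd'' k hk0 hk1, hd'σ]
    · intro k
      by_cases hk0 : k = i₀
      · rw [hk0, hd₀, hd₁, inv_mul_cancel₀ hP0]
      by_cases hk1 : k = Fin.rev i₀
      · rw [hk1, hd₁, Fin.rev_rev, hd₀, mul_inv_cancel₀ hP0]
      · rw [hd'' k hk0 hk1, hd'' (Fin.rev k) (fun h => hk1 (by rw [← h, Fin.rev_rev]))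
          (fun h => hk0 (Fin.rev_injective h)), hd'inv]
    · intro k hk
      have hk0 : k ≠ i₀ := fun h => hk (h ▸ hi₀S)
      have hk1 : k ≠ Fin.rev i₀ := fun h => hk (h ▸ hi₁S)
      rw [hd'' k hk0 hk1, hd'1 k (fun h => hk (hsub.subset h))]
    · -- the lattice identity `M = ψ (t_d 𝒪^S)`
      obtain ⟨-, hLdec⟩ := hL.restrict hB (isHyperbolicPair_single hi₀)
        (mem_frameLattice.2 ⟨single_mem_stdLattice i₀, single_mem_frame hi₀S⟩)
        (mem_frameLattice.2 ⟨single_mem_stdLattice _, single_mem_frame hi₁S⟩)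
      rw [frameLattice_inf_orthInt_single] at hLdec
      have h1 : (frameLattice K N S).map ((Matrix.toLin' (Matrix.diagonal d)).restrictScalars 𝒪[K]) =
          Submodule.span 𝒪[K] {P⁻¹ • (Pi.single i₀ 1 : Fin N → K), P • Pi.single (Fin.rev i₀) 1} ⊔
            (frameLattice K N ((S.erase i₀).erase (Fin.rev i₀))).map
              ((Matrix.toLin' (Matrix.diagonal d')).restrictScalars 𝒪[K]) := by
        rw [hLdec, Submodule.map_sup, map_span_pair, toLin'_diagonal_single, toLin'_diagonal_single, hd₀, hd₁,
          map_eq_map_of_eqOn hagree]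
      have h2 : (Submodule.span 𝒪[K] {P⁻¹ • (Pi.single i₀ 1 : Fin N → K), P • Pi.single (Fin.rev i₀) 1} ⊔
            (frameLattice K N ((S.erase i₀).erase (Fin.rev i₀))).map
              ((Matrix.toLin' (Matrix.diagonal d')).restrictScalars 𝒪[K])).map
              (ψ'.toLinearMap.restrictScalars 𝒪[K]) = M.map (φ.symm.toLinearMap.restrictScalars 𝒪[K]) := by
        rw [Submodule.map_sup, map_span_pair, ← hM₁'eq, LinearEquiv.coe_coe, map_smul, map_smul,
          hψ'fix _ hi₀S', hψ'fix _ hi₁S']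
        exact hM₁dec.symm
      rw [map_trans, h1, h2, map_symm_map]

/-- **The frame induction** (see the module docstring), for the non-dyadic datum `LocalConjDatum σ ϖ` — the
specialisation of `UnramifiedLocalConjDatum.exists_frame_cartan` along `LocalConjDatum.toUnramified`.
[cite: Tits1979, §3.3.3] -/
theorem exists_frame_cartan (hd : LocalConjDatum σ ϖ) (S : Finset (Fin N)) (hS : ∀ i ∈ S, Fin.rev i ∈ S)
    (M : Submodule 𝒪[K] (Fin N → K)) (hM : IsUnimodularLattice (B₀ σ N) (frame K N S) M) :
    ∃ (ψ : (Fin N → K) ≃ₗ[K] (Fin N → K)) (d : Fin N → K),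
      (∀ u v, B₀ σ N (ψ u) (ψ v) = B₀ σ N u v) ∧
      (∀ i, i ∉ S → ψ (Pi.single i 1) = Pi.single i 1) ∧
      (stdLattice K N).map (ψ.toLinearMap.restrictScalars 𝒪[K]) = stdLattice K N ∧
      (∀ i, σ (d i) = d i) ∧ (∀ i, d i * d (Fin.rev i) = 1) ∧ (∀ i, i ∉ S → d i = 1) ∧
      M = ((frameLattice K N S).map ((Matrix.toLin' (Matrix.diagonal d)).restrictScalars 𝒪[K])).map
            (ψ.toLinearMap.restrictScalars 𝒪[K]) :=
  hd.toUnramified.exists_frame_cartan S hS M hM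

end Literature.NumberTheory.Automorphic.HermitianLattice

end
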